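import Summits.QuantumFields.YangMills.Theorems.BalabanUVNodesK0Beta13RadiusBlind
import Summits.QuantumFields.YangMills.Theorems.BalabanUVNodesN09B0RiderAtRecord

/-!
# K0⁷ — RADIUS BLINDNESS OF THE β OF RECORD: rows (N) and (B) of (T2″) DISCHARGED at the small-field domain system from the n09-lineage tree theorems
# ((T2‴): the bill of the radius-blindness lemma at the print-regime Z3 member = (T1) selector agreement + continuity of the transforms (one radius) +
#  [15] Thm 1 existence on the domains + NUMERICS)

Cell `pub-ymgap`, width seat `pub-ymgap-dag-n07-w3` (g19; N07 [B11] ∕ K0⁷ junction).  `--kind proof --supports stmt-QuantumFields-20541 --as helper`, COUNT-NEUTRAL.  NEW leaf;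
theorems only — 0 `def`, 0 `sorry`, 0 `instance`, 0 `notation`.  Imports this seat's `…K0Beta13RadiusBlind` ((T2″), ✓p785962) and dag-n09-w4 g3's `…N09B0RiderAtRecord`
(the p.267 rider `hb0` and the support clause `hχdom` as theorems; dag-n09-w1's [B7] Prop-2 nesting `hcrit_dom_of_hsolv` through it).
[I] = [Balaban1987RG1]; [III] = [Balaban1988Convergent]; [B7] = [Balaban1985Averaging]; [15] = [Balaban1985Variational].

WHY.  (T2″) `…K0Beta13RadiusBlind.betaOfRecord₁₃_thm1CCMWZB_radiusBlind_of_readSet` displays four row families on an abstract open domain system `U K k ∋ 1`: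
(hU) selector agreement, (C) continuity of the transforms on `U`, (N) the support of the (2.9) cutoff over `U_{k+1}` lies in `U_k`, (B) averaged backgrounds of `U_{k+1}` lie in `U_k`.
At the CONCRETE domain system `U K k := domAltOfRecord F N ν K k = {V | |∂V − 1| < ε₀}` of a numerics `ν` with `ν.εreg = a` and a POSITIVE domain letter `ε₀` (the Z3 member
`θ₁₃ᶜᶜᴹᵂᶻᴮ(j; γ; a; ε₀, ε₂₉; B₃, B₃′, a, a₁; …)` — the β of record does not read `ε₀`, `rfl`), rows (N) and (B) ARE TREE THEOREMS under numerics and [15] Thm 1 existence on the domains: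
(N) = dag-n09-w4's `hχdom_of_hsolν_of_numerics` (threshold hierarchy [III] p.265 + the p.267 rider + [B7] Prop 2); (B) = dag-n09-w1's `hcrit_dom_of_hsolv` ([B7] Prop 2 (53)) read through
`critCfgOfRecord_def` and the threshold ordering.  THIS FILE composes them: ★ `betaOfRecord₁₃_thm1CCMWZB_radiusBlind_atDomAlt` (member letters free, `0 < ε₀`) and ★★
`betaZB_radiusBlind_atDomAlt` — seat -3's `betaZB F a ε₂₉ = betaZB F a′ ε₂₉` (the `ε₀ = 0` member, reached from any positive `ε₀` by the letter census) from: (hU) selector agreement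
of the radii `a, a′` ON THE DOMAINS (the node's (T1)), (hT) `HasContTransportOn` of the level-`k` β-densities of the `a`-member on `domAlt_{k+1}` (K0e's on-domain continuity species, ONE
radius), (hsolν) `UkExists` at radius `a` on the domains ([15] Thm 1, N07's content), and NUMERICS on `(a, ε₂₉, ε₀, L, N)` (dag-n09-w4's letters verbatim + the threshold ordering).

HONEST FRAMING (binding).  A composition BY NAME of landed theorems; NO β estimate; nothing of Bałaban's asserted — (hU), (hT), (hsolν) are displayed HYPOTHESES (idea-needed (T1);
the record-regularity species of row P7; [15] Thm 1), the numerics are displayed inequalities inhabited by nobody here; seat -3's (T2) AS TYPED is NOT proved; stub 2′ OPEN; K0⁷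
stmt-QuantumFields-20541 NOT closed; N07 ∕ N09 NOT discharged; COUNT 8∕28 · K 1∕4 UNMOVED; NODE O = [I] Thm 3 β-clause p.264 — print-proved (claimed), UNPORTED; R4 = the
CONDITIONAL finite-𝕋⁴ rung `BalabanLadder.UV` at fixed `ε = L^(−K)` only — NOT continuum ∕ ℝ⁴ ∕ OS; the Yang–Mills mass gap (Clay) is NOT proved by any of this.  Standard axioms only.
-/

noncomputable section

open MeasureTheory Set Filter
open scoped Matrix.Norms.L2Operator

namespace Summit.QuantumFields.YangMills.BalabanUVNodes.K0Beta13RadiusBlindRows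

open Literature.MathematicalPhysics.QuantumFieldTheory.Balaban1983to89
open Literature.MathematicalPhysics.QuantumFieldTheory.Balaban1983to89.Node00
open Literature.MathematicalPhysics.QuantumFieldTheory.Balaban1983to89.T4Continuum (T4Family)
open Literature.MathematicalPhysics.QuantumFieldTheory.Balaban1983to89.ExpMeanLog (deltaSU)
open B12Eq019ActionBody (integrand)
open B12ContinuousTransportInvarianceOn (isOpen_domAltOfRecord)
open Summit.QuantumFields.YangMills.BalabanUVNodes.K0Beta13RadiusBlind (betaOfRecord₁₃_thm1CCMWZB_radiusBlind_of_readSet)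
open Summit.QuantumFields.YangMills.BalabanUVNodes.N09B0RiderAtRecord (hχdom_of_hsolν_of_numerics)
open Summit.QuantumFields.YangMills.BalabanUVNodes.N09NestingOfHierAxial (hcrit_dom_of_hsolv)

variable (F : T4Family) (N : ℕ) [NeZero N]

/-- ★ **(T2″) AT THE SMALL-FIELD DOMAIN SYSTEM — rows (N) and (B) discharged.**  For the print-regime Z3 members `θ₁₃ᶜᶜᴹᵂᶻᴮ(j; γ; a; ε₀, ε₂₉; B₃, B₃′, a, a₁; Efl, logz)` and `(… a′ …)` with a
POSITIVE domain letter `ε₀`: if (hU) the background selectors of record at the radii `a, a′` agree on the small-field domains `domAlt_{k+1} = {W | |∂W − 1| < ε₀}`, (hT) the transform of record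
of every level-`k` β-density of the `a`-member has a continuous version on `domAlt_{k+1}` (`HasContTransportOn`, one radius), (hsolν) the radius-`a` variational problem is solvable on the domains
([15] Thm 1), and the numerics of dag-n09-w4's rider ∕ dag-n09-w1's [B7] nesting and the threshold ordering `2a∕L² + 4·max(ε₂₉, 10(d+2)L·L^{d−1}ε₂₉) ≤ ε₀` hold — then the two members have THE
SAME β of record (every level, every history).  Rows (N)(B) of (T2″) are supplied by `hχdom_of_hsolν_of_numerics` and `hcrit_dom_of_hsolv`; (hU)(hT)(hsolν) and the numerics stay displayed.
[cite: Balaban1987RG1, (1.20)–(1.22) p.264, (1.6) p.261, (0.19) p.255, p.259, (2.3) p.265, (2.9) p.266 and p.267; Balaban1988Convergent, p.265; Balaban1985Averaging, Prop. 2 (53) p.26; Balaban1985Variational, Thm 1 (8)–(10) p.279 (bookkeeping)] -/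
theorem betaOfRecord₁₃_thm1CCMWZB_radiusBlind_atDomAlt (j : ℕ) (γ ε₀ ε₂₉ B₃ B₃' a₁ a a' : ℝ) (Efl logz : B12.RunParams → ℕ → ℝ)
    (hε₀ : 0 < ε₀) (ha : 0 < a) (hε29 : 0 ≤ ε₂₉)
    (hε3 : ∀ K : ℕ, (143 * (((((F.P K).d + 4 : ℕ) : ℝ)) ^ 2 / 4) ^ 2) * a ≤ 1 / 3)
    (hε2 : ∀ K : ℕ, 2 * a ≤ 2 * deltaSU (Fin N) / ((((F.P K).d + 4) * (F.P K).L : ℕ) : ℝ) ^ 2)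
    (hn1 : ∀ K : ℕ, 1640 * (2 * (((((F.P K).d + 2) * (F.P K).L : ℕ) : ℝ) * ε₂₉) +
        ((((F.P K).d + 2) * (F.P K).L : ℕ) : ℝ) ^ 2 / 4 * (2 * a / ((F.P K).L : ℝ) ^ 2)) * (((F.P K).L : ℝ) ^ ((F.P K).d - 1)) ^ 2 ≤ 1)
    (hn2 : ∀ K : ℕ, 13 * (2 * (((((F.P K).d + 2) * (F.P K).L : ℕ) : ℝ) * ε₂₉) +
        ((((F.P K).d + 2) * (F.P K).L : ℕ) : ℝ) ^ 2 / 4 * (2 * a / ((F.P K).L : ℝ) ^ 2)) * ((F.P K).L : ℝ) ^ ((F.P K).d - 1) < deltaSU (Fin N))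
    (hord : ∀ K : ℕ, 2 * a / ((F.P K).L : ℝ) ^ 2 +
      4 * max ε₂₉ (10 * (((((F.P K).d + 2) * (F.P K).L : ℕ) : ℝ) * ε₂₉) * ((F.P K).L : ℝ) ^ ((F.P K).d - 1)) ≤ ε₀)
    (hsolν : ∀ K : ℕ, ∀ k < K, ∀ W ∈ domAltOfRecord F N (numerics7OfThm1CCM F.L j ε₀ B₃ B₃' a a₁) K (k + 1), UkExists F N K (k + 1) a W)
    (hU : ∀ K k W, k < K → W ∈ domAltOfRecord F N (numerics7OfThm1CCM F.L j ε₀ B₃ B₃' a a₁) K (k + 1) → Uk F N K (k + 1) a W = Uk F N K (k + 1) a' W)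
    (hT : ∀ K (g : ℕ → ℝ) k, k < K → HasContTransportOn F N K k
      (integrand (chiFixed29 F N (numerics7OfThm1CCM F.L j ε₀ B₃ B₃' a a₁) ε₂₉ K g k) (gfOfRecord F N K k) (g k)
        (effActionHT F N (TcanOfRecord F N) (chiFixed29 F N (numerics7OfThm1CCM F.L j ε₀ B₃ B₃' a a₁) ε₂₉) K g k))
      (domAltOfRecord F N (numerics7OfThm1CCM F.L j ε₀ B₃ B₃' a a₁) K (k + 1))) :
    betaOfRecord₁₃ F N (theta13OfThm1CCMWZB F N j γ a ε₀ ε₂₉ B₃ B₃' a a₁ Efl logz) =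
      betaOfRecord₁₃ F N (theta13OfThm1CCMWZB F N j γ a' ε₀ ε₂₉ B₃ B₃' a' a₁ Efl logz) := by
  -- the `a`-member, its numerics `ν` (εreg = a, ε₀ = ε₀ by `rfl`)
  set θ := theta13OfThm1CCMWZB F N j γ a ε₀ ε₂₉ B₃ B₃' a a₁ Efl logz with hθ
  have hν : θ.ν = numerics7OfThm1CCM F.L j ε₀ B₃ B₃' a a₁ := rfl
  have hreg : θ.ν.εreg = a := rfl
  have hε0 : θ.ν.ε₀ = ε₀ := rfl
  have h29 : θ.ε₂₉ = ε₂₉ := rfl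
  refine betaOfRecord₁₃_thm1CCMWZB_radiusBlind_of_readSet F N j γ ε₀ ε₂₉ B₃ B₃' a₁ a a' Efl logz
    (fun K k => domAltOfRecord F N θ.ν K k) (fun K k => isOpen_domAltOfRecord θ.ν K k)
    (fun K k => one_mem_domAltOfRecord θ.ν (by rw [hε0]; exact hε₀) K k) hU ?_ ?_ ?_
  · -- (C) from the on-domain continuity tokens
    intro K g k hk
    exact domAlt_subset_regSetOfRecord θ.ν (hT K g k hk)
  · -- (N): the support clause `hχdom` (threshold hierarchy + rider + [B7] Prop 2), contraposed
    intro K k V hk hV hz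
    by_contra hV'
    have h0 := hχdom_of_hsolν_of_numerics θ K (fun _ => 0) (by rw [hreg]; exact ha) (by rw [hreg]; exact hε3 K) (by rw [hreg]; exact hε2 K)
      (by rw [h29]; exact hε29) (by rw [hreg, h29]; exact hn1 K) (by rw [hreg, h29]; exact hn2 K) (by rw [hreg, h29, hε0]; exact hord K)
      (by rw [hreg]; exact hsolν K) k hk V hV hV'
    exact hz h0
  · -- (B): [B7] Prop-2 nesting of the averaged background, through `critCfgOfRecord_def` and the threshold ordering
    intro K k W hk hW
    have hL0 : (0 : ℝ) < (F.P K).L := by exact_mod_cast (F.P K).L_pos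
    have hδ : 2 * θ.ν.εreg ≤ θ.ν.ε₀ * ((F.P K).L : ℝ) ^ 2 := by
      rw [hreg, hε0]
      have h1 : 2 * a / ((F.P K).L : ℝ) ^ 2 ≤ ε₀ :=
        le_trans (le_add_of_nonneg_right (by positivity)) (hord K)
      rwa [div_le_iff₀ (by positivity)] at h1
    have hc := hcrit_dom_of_hsolv θ.ν (by rw [hreg]; exact ha) (by rw [hreg]; exact hε3 K) (by rw [hreg]; exact hε2 K) hδ
      (by rw [hreg]; exact hsolν K) k hk W hW
    rw [critCfgOfRecord_def, hreg] at hc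
    exact hc

/-- ★★ **(T2‴) IN THE NODE'S LETTERS — `betaZB F a ε₂₉ = betaZB F a′ ε₂₉`** (seat -3's `betaZB F a₀ ε₂₉ := betaOfRecord₁₃ F N (θ₁₃ᶜᶜᴹᵂᶻᴮ(0; ½; a₀; 0, ε₂₉; 0, 0, a₀, 0; 0, 0))`, by unfolding)
FROM: a positive domain letter `ε₀` (β does not read it — the letter census, `rfl`), (hU) selector agreement of the radii `a, a′` on the small-field domains `{|∂W − 1| < ε₀}` (the node's
(T1)), (hT) on-domain continuity of the transforms of the `a`-member's β-densities (ONE radius; the record-regularity species of row P7), (hsolν) [15] Thm 1 existence at radius `a` on the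
domains, and NUMERICS on `(a, ε₂₉, ε₀, L, N)`.  The corrected, honestly-priced replacement of `stub_beta13_radiusBlind`. [cite: Balaban1987RG1, (1.20)–(1.22) p.264, (0.21) p.256, p.259, (2.9) p.266 and p.267; Balaban1988Convergent, p.265; Balaban1985Averaging, Prop. 2 (53) p.26; Balaban1985Variational, Thm 1 (8)–(10) p.279 (bookkeeping)] -/
theorem betaZB_radiusBlind_atDomAlt (ε₀ ε₂₉ a a' : ℝ) (hε₀ : 0 < ε₀) (ha : 0 < a) (hε29 : 0 ≤ ε₂₉)
    (hε3 : ∀ K : ℕ, (143 * (((((F.P K).d + 4 : ℕ) : ℝ)) ^ 2 / 4) ^ 2) * a ≤ 1 / 3)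
    (hε2 : ∀ K : ℕ, 2 * a ≤ 2 * deltaSU (Fin N) / ((((F.P K).d + 4) * (F.P K).L : ℕ) : ℝ) ^ 2)
    (hn1 : ∀ K : ℕ, 1640 * (2 * (((((F.P K).d + 2) * (F.P K).L : ℕ) : ℝ) * ε₂₉) +
        ((((F.P K).d + 2) * (F.P K).L : ℕ) : ℝ) ^ 2 / 4 * (2 * a / ((F.P K).L : ℝ) ^ 2)) * (((F.P K).L : ℝ) ^ ((F.P K).d - 1)) ^ 2 ≤ 1)
    (hn2 : ∀ K : ℕ, 13 * (2 * (((((F.P K).d + 2) * (F.P K).L : ℕ) : ℝ) * ε₂₉) +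
        ((((F.P K).d + 2) * (F.P K).L : ℕ) : ℝ) ^ 2 / 4 * (2 * a / ((F.P K).L : ℝ) ^ 2)) * ((F.P K).L : ℝ) ^ ((F.P K).d - 1) < deltaSU (Fin N))
    (hord : ∀ K : ℕ, 2 * a / ((F.P K).L : ℝ) ^ 2 +
      4 * max ε₂₉ (10 * (((((F.P K).d + 2) * (F.P K).L : ℕ) : ℝ) * ε₂₉) * ((F.P K).L : ℝ) ^ ((F.P K).d - 1)) ≤ ε₀)
    (hsolν : ∀ K : ℕ, ∀ k < K, ∀ W ∈ domAltOfRecord F N (numerics7OfThm1CCM F.L 0 ε₀ 0 0 a 0) K (k + 1), UkExists F N K (k + 1) a W)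
    (hU : ∀ K k W, k < K → W ∈ domAltOfRecord F N (numerics7OfThm1CCM F.L 0 ε₀ 0 0 a 0) K (k + 1) → Uk F N K (k + 1) a W = Uk F N K (k + 1) a' W)
    (hT : ∀ K (g : ℕ → ℝ) k, k < K → HasContTransportOn F N K k
      (integrand (chiFixed29 F N (numerics7OfThm1CCM F.L 0 ε₀ 0 0 a 0) ε₂₉ K g k) (gfOfRecord F N K k) (g k)
        (effActionHT F N (TcanOfRecord F N) (chiFixed29 F N (numerics7OfThm1CCM F.L 0 ε₀ 0 0 a 0) ε₂₉) K g k))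
      (domAltOfRecord F N (numerics7OfThm1CCM F.L 0 ε₀ 0 0 a 0) K (k + 1))) :
    betaOfRecord₁₃ F N (theta13OfThm1CCMWZB F N 0 (1 / 2) a 0 ε₂₉ 0 0 a 0 (fun _ _ => 0) (fun _ _ => 0)) =
      betaOfRecord₁₃ F N (theta13OfThm1CCMWZB F N 0 (1 / 2) a' 0 ε₂₉ 0 0 a' 0 (fun _ _ => 0) (fun _ _ => 0)) := by
  have h := betaOfRecord₁₃_thm1CCMWZB_radiusBlind_atDomAlt F N 0 (1 / 2) ε₀ ε₂₉ 0 0 0 a a' (fun _ _ => 0) (fun _ _ => 0) hε₀ ha hε29 hε3 hε2 hn1 hn2 hord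
    hsolν hU hT
  -- the letter census: the β of record does not read `ε₀` (`rfl`)
  have ha₀ : betaOfRecord₁₃ F N (theta13OfThm1CCMWZB F N 0 (1 / 2) a ε₀ ε₂₉ 0 0 a 0 (fun _ _ => 0) (fun _ _ => 0)) =
      betaOfRecord₁₃ F N (theta13OfThm1CCMWZB F N 0 (1 / 2) a 0 ε₂₉ 0 0 a 0 (fun _ _ => 0) (fun _ _ => 0)) := rfl
  have ha₁ : betaOfRecord₁₃ F N (theta13OfThm1CCMWZB F N 0 (1 / 2) a' ε₀ ε₂₉ 0 0 a' 0 (fun _ _ => 0) (fun _ _ => 0)) =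
      betaOfRecord₁₃ F N (theta13OfThm1CCMWZB F N 0 (1 / 2) a' 0 ε₂₉ 0 0 a' 0 (fun _ _ => 0) (fun _ _ => 0)) := rfl
  rw [← ha₀, ← ha₁]
  exact h

end Summit.QuantumFields.YangMills.BalabanUVNodes.K0Beta13RadiusBlindRows
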